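import Mathlib
import Summits.Ventures.PercRepro2.HMFRootEdgeChordTheorem

/-!
# All root edges at `a₃` may be zeroed at once (blind cell PercRepro2, night-1 g18;
NIGHT1-G18.md §2′)

`RootEdge.HMF_of_root_edge` / `HMF_of_root2_edge` (and the (HCOV) forms) delete ONE edge from `a₃`
to a root.  By induction over a finite set `F` of such edges, (HMF) and (HCOV) on the instance with
every edge of `F` zeroed give (HMF) and (HCOV) on the instance itself:

* **`HMF_of_zero_root_edges`** / **`HCov_of_zero_root_edges`**: for `F ⊆ {e | ends e = {a₃, a₁} ∨
  ends e = {a₃, a₂}}`, `HMF (zeroOn p F) → HMF p` (resp. (HCOV)), `zeroOn p F = (e ↦ if e ∈ F then 0 else p e)`.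

So every class theorem of the table applies AFTER the root edges at `a₃` are removed: any reduct's
edges `a₃ – a₁`, `a₃ – a₂` (any multiplicity) are invisible to the classes.  Own code; standard
axioms.
-/

namespace Summit.Ventures.PercRepro2

open UnionCluster CovForm

namespace RootEdge

section Zero

variable {V : Type*} {E : Type*} [Fintype E] [DecidableEq E] [Fintype V] [DecidableEq V]
  {R : Type*} [Field R] [LinearOrder R] [IsStrictOrderedRing R]

variable (p : E → R) (ends : E → Sym2 V) (o a₁ a₂ a₃ b : V)

/-- The weights with every edge of `F` set to `0`. -/
noncomputable def zeroOn (F : Finset E) : E → R := fun e => if e ∈ F then 0 else p e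

omit [Fintype E] [Fintype V] [DecidableEq V] [LinearOrder R] [IsStrictOrderedRing R] in
/-- `zeroOn p ∅ = p`. -/
lemma zeroOn_empty : zeroOn p (∅ : Finset E) = p := by
  funext e
  simp [zeroOn]

omit [Fintype E] [Fintype V] [DecidableEq V] [LinearOrder R] [IsStrictOrderedRing R] in
/-- `zeroOn p (insert e F) = (zeroOn p F)[e ↦ 0]`. -/
lemma zeroOn_insert (F : Finset E) (e : E) :
    zeroOn p (insert e F) = Function.update (zeroOn p F) e 0 := by
  funext e'
  by_cases h : e' = e
  · subst h; simp [zeroOn]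
  · simp [zeroOn, h]

omit [Fintype E] [Fintype V] [DecidableEq V] in
/-- Zeroing edges keeps the weights admissible. -/
lemma isProbVec_zeroOn (hp : IsProbVec p) (F : Finset E) : IsProbVec (zeroOn p F) := by
  refine ⟨fun e => ?_, fun e => ?_⟩ <;> unfold zeroOn <;> split_ifs
  · exact le_rfl
  · exact hp.nonneg e
  · exact zero_le_one
  · exact hp.le_one e

/-- **(HMF) after zeroing any finite set of root edges at `a₃` gives (HMF)**. -/
theorem HMF_of_zero_root_edges (hp : IsProbVec p) (F : Finset E)
    (hF : ∀ e ∈ F, ends e = s(a₃, a₁) ∨ ends e = s(a₃, a₂))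
    (h : HMF (zeroOn p F) ends o a₁ a₂ a₃ b) : HMF p ends o a₁ a₂ a₃ b := by
  induction F using Finset.induction_on with
  | empty => rwa [zeroOn_empty] at h
  | insert e F he ih =>
    refine ih (fun e' he' => hF e' (Finset.mem_insert_of_mem he')) ?_
    rw [zeroOn_insert] at h
    rcases hF e (Finset.mem_insert_self e F) with hf | hf
    · exact HMF_of_root_edge (zeroOn p F) ends o b (isProbVec_zeroOn p hp F) hf h
    · exact HMF_of_root2_edge (zeroOn p F) ends o b (isProbVec_zeroOn p hp F) hf h

/-- **(HCOV) after zeroing any finite set of root edges at `a₃` gives (HCOV)**. -/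
theorem HCov_of_zero_root_edges (hp : IsProbVec p) (F : Finset E)
    (hF : ∀ e ∈ F, ends e = s(a₃, a₁) ∨ ends e = s(a₃, a₂))
    (h : HCov (zeroOn p F) ends o a₁ a₂ a₃ b) : HCov p ends o a₁ a₂ a₃ b := by
  induction F using Finset.induction_on with
  | empty => rwa [zeroOn_empty] at h
  | insert e F he ih =>
    refine ih (fun e' he' => hF e' (Finset.mem_insert_of_mem he')) ?_
    rw [zeroOn_insert] at h
    rcases hF e (Finset.mem_insert_self e F) with hf | hf
    · exact HCov_of_root_edge (zeroOn p F) ends o b (isProbVec_zeroOn p hp F) hf h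
    · exact HCov_of_root2_edge (zeroOn p F) ends o b (isProbVec_zeroOn p hp F) hf h

/-- **All root edges at `a₃` zeroed**: (HMF) on the instance without any edge from `a₃` to a root
gives (HMF). -/
theorem HMF_of_zero_all_root_edges (hp : IsProbVec p)
    (h : HMF (zeroOn p (Finset.univ.filter fun e => ends e = s(a₃, a₁) ∨ ends e = s(a₃, a₂)))
      ends o a₁ a₂ a₃ b) : HMF p ends o a₁ a₂ a₃ b :=
  HMF_of_zero_root_edges p ends o a₁ a₂ a₃ b hp _ (fun _ he => (Finset.mem_filter.1 he).2) h

/-- **All root edges at `a₃` zeroed**: (HCOV) on the instance without any edge from `a₃` to a root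
gives (HCOV). -/
theorem HCov_of_zero_all_root_edges (hp : IsProbVec p)
    (h : HCov (zeroOn p (Finset.univ.filter fun e => ends e = s(a₃, a₁) ∨ ends e = s(a₃, a₂)))
      ends o a₁ a₂ a₃ b) : HCov p ends o a₁ a₂ a₃ b :=
  HCov_of_zero_root_edges p ends o a₁ a₂ a₃ b hp _ (fun _ he => (Finset.mem_filter.1 he).2) h

end Zero

end RootEdge

end Summit.Ventures.PercRepro2
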